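import Summits.Ventures.CertifiedManyBodySolver.Downfold.TperpSeamSharp
import Summits.Ventures.CertifiedManyBodySolver.Downfold.BoxesYBCO6
import HarnessLib

/-!
# Seam ENTRY POINTS on the typed YBa₂Cu₃O₆.₀₀ BILAYER PARENT box `boxYBCO6M_M64` (object M, n = 1): vertical, sharp, every-pattern and
# hubbard-box-p1's BILAYER seam keyed on the box's on-top `tperp/t = t⊥₀/t ∈ [0.22, 0.29]` row — the half-filled twin of `BoxesYBCO7Words.lean`

Venture CertifiedManyBodySolver, cell `pub/hubbard-downfold` (stage S1 ↔ S2 seam), seat hubbard-downfold-mod-1; namespace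
`Summit.Ventures.CertifiedManyBodySolver.Downfold`. `boxYBCO6M_M64` (`BoxesYBCO6.lean`, VSET #64, box of record #139 «1BH+3BE+CI»:
`U/t ∈ [5.4, 13.6] × tp/t ∈ [−0.28, −0.15] × n ∈ [0.99, 1.01]`, `tperp/t ∈ [0.22, 0.29]` = |H₁₂(R = 0)|/t, `tpp/t ∈ [0.13, 0.24]`). No S2 window covers its
`(tp/t, n)` cell yet (the near-half-filling La-214 words stop at `tp/t ≤ −1/5`), so — exactly as for the doped bilayer box — this file lands the
WINDOW-PARAMETRIC entry points: any future `_word_Icc` statement on `Set.Icc ![27/5, -7/25, 99/100] ![68/5, -3/20, 101/100]` becomes a word with one line: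
* `boxYBCO6M_M64_layeredEnergyWord` (constant 2: `[L − 2·(29/100), R]`), `_sharp` (`4/π`), `_pattern` (every interlayer pattern with `Σ|tz_b| ≤ |p tperp/t|`);
* `boxYBCO6M_M64_bilayerEnergyWord` — hubbard-box-p1's BILAYER seam (period-2 stacking, intra-bilayer `p tperp/t`, any inter-bilayer `|t⊥'| ≤ |p tperp/t|`):
  `[L − 2·(29/100), R]` for the variational cell energy over period-2 periodic states at cell filling `p n` (= 1 ± 0.01 here: the CHARGE-INSULATOR parent;
  an AF / charge-gap window certificate at n = 1 on this cell is the informative annex the box file asks for).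
(The object-M `t''` entry points `boxYBCO6M_M64_energyWord_kinematic/_four` are in `BoxesYBCO6.lean`.) HONEST FRAMING: entry points only — no number
about YBa₂Cu₃O₆ is stated until an S2 window is plugged in; energy words only; nothing about order, the insulating gap, `T_N` or a phase word.
Everything is PROVED; no definition, no `sorry`.
-/

noncomputable section

namespace Summit.Ventures.CertifiedManyBodySolver.Downfold

open NonemptyInterval Literature.MathematicalPhysics.QuantumLattice
  Literature.MathematicalPhysics.QuantumLattice.ThermodynamicLimit Literature.Probability.LatticeModels

/-- The `tperp/t` magnitude of `boxYBCO6M_M64`: `max |11/50| |29/100| = 29/100`. [folklore] -/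
theorem yBCO6M_M64_tperp_abs : (max |yBCO6M_M64_tperp.encl.fst| |yBCO6M_M64_tperp.encl.snd| : ℚ) = 29/100 := by
  rw [yBCO6M_M64_tperp, Entry.encl_ofEnds_fst, Entry.encl_ofEnds_snd, abs_of_nonneg (by norm_num), abs_of_nonneg (by norm_num)]
  norm_num

/-- **Layered-crystal entry point on `boxYBCO6M_M64`, simple tetragonal stacking (constant 2):** an S2 window `[L, R]` on the cell
`Set.Icc ![27/5, -7/25, 99/100] ![68/5, -3/20, 101/100]` gives `L − 2·(29/100) ≤ e_{p n}(vertical crystal) ≤ R` on the box. [folklore] -/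
theorem boxYBCO6M_M64_layeredEnergyWord {L R : ℝ}
    (hE : ∀ θ ∈ Set.Icc (![27/5, -7/25, 99/100] : Fin 3 → ℝ) ![68/5, -3/20, 101/100],
      L ≤ energyDensityTT' 1 (θ 1) (θ 0) (θ 2) ∧ energyDensityTT' 1 (θ 1) (θ 0) (θ 2) ≤ R) :
    HoldsOn (fun p : OneBandCoord → ℝ =>
      L - 2 * (29/100 : ℝ) ≤
          (layeredHubbardTTPrime 1 (p .tpOverT) (p .UOverT) (fun _ : Fin 1 => (unitVec (0 : Fin 3) : Site 3))
            fun _ => p .tperpOverT).tiGroundEnergyDensityAt 1 (p .filling) ∧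
        (layeredHubbardTTPrime 1 (p .tpOverT) (p .UOverT) (fun _ : Fin 1 => (unitVec (0 : Fin 3) : Site 3))
            fun _ => p .tperpOverT).tiGroundEnergyDensityAt 1 (p .filling) ≤ R) boxYBCO6M_M64 := by
  have h := holdsOn_verticalHubbardTTPrime_of_window (B := boxYBCO6M_M64) (eU := yBCO6M_M64_U) (eS := yBCO6M_M64_tp)
    (eN := yBCO6M_M64_n) (eZ := yBCO6M_M64_tperp) rfl rfl rfl rfl
    (by rw [yBCO6M_M64_U, Entry.encl_ofEnds_fst]; norm_num)
    (by rw [yBCO6M_M64_n, Entry.encl_ofEnds_fst]; norm_num)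
    (by rw [yBCO6M_M64_n, Entry.encl_ofEnds_snd]; norm_num)
    (L := L) (R := R) (by rw [yBCO6M_M64_s2Lo, yBCO6M_M64_s2Hi]; exact hE)
  rw [yBCO6M_M64_tperp_abs] at h
  have hc : (((29/100 : ℚ)) : ℝ) = (29/100 : ℝ) := by norm_num
  rw [hc] at h
  exact h

/-- **SHARP layered-crystal entry point on `boxYBCO6M_M64`** (hubbard-box-p1's constant `4/π`): `L − (4/π)·(29/100) ≤ e ≤ R`. [folklore] -/
theorem boxYBCO6M_M64_layeredEnergyWord_sharp {L R : ℝ}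
    (hE : ∀ θ ∈ Set.Icc (![27/5, -7/25, 99/100] : Fin 3 → ℝ) ![68/5, -3/20, 101/100],
      L ≤ energyDensityTT' 1 (θ 1) (θ 0) (θ 2) ∧ energyDensityTT' 1 (θ 1) (θ 0) (θ 2) ≤ R) :
    HoldsOn (fun p : OneBandCoord → ℝ =>
      L - 4 / Real.pi * (29/100 : ℝ) ≤
          (layeredHubbardTTPrime 1 (p .tpOverT) (p .UOverT) (fun _ : Fin 1 => (unitVec (0 : Fin 3) : Site 3))
            fun _ => p .tperpOverT).tiGroundEnergyDensityAt 1 (p .filling) ∧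
        (layeredHubbardTTPrime 1 (p .tpOverT) (p .UOverT) (fun _ : Fin 1 => (unitVec (0 : Fin 3) : Site 3))
            fun _ => p .tperpOverT).tiGroundEnergyDensityAt 1 (p .filling) ≤ R) boxYBCO6M_M64 := by
  have h := holdsOn_verticalHubbardTTPrime_of_window_sharp (B := boxYBCO6M_M64) (eU := yBCO6M_M64_U) (eS := yBCO6M_M64_tp)
    (eN := yBCO6M_M64_n) (eZ := yBCO6M_M64_tperp) rfl rfl rfl rfl
    (by rw [yBCO6M_M64_U, Entry.encl_ofEnds_fst]; norm_num)
    (by rw [yBCO6M_M64_n, Entry.encl_ofEnds_fst]; norm_num)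
    (by rw [yBCO6M_M64_n, Entry.encl_ofEnds_snd]; norm_num)
    (L := L) (R := R) (by rw [yBCO6M_M64_s2Lo, yBCO6M_M64_s2Hi]; exact hE)
  rw [yBCO6M_M64_tperp_abs] at h
  have hc : (((29/100 : ℚ)) : ℝ) = (29/100 : ℝ) := by norm_num
  rw [hc] at h
  exact h

/-- **Layered-crystal entry point on `boxYBCO6M_M64`, EVERY interlayer pattern** (`(w_b)₀ ≠ 0`, range box `R' ≥ 1`, `Σ_b |tz_b| ≤ |p tperp/t|`):
`L − 2·(29/100) ≤ e_{p n}(layered crystal) ≤ R` on the box. [folklore] -/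
theorem boxYBCO6M_M64_layeredEnergyWord_pattern {L R : ℝ}
    (hE : ∀ θ ∈ Set.Icc (![27/5, -7/25, 99/100] : Fin 3 → ℝ) ![68/5, -3/20, 101/100],
      L ≤ energyDensityTT' 1 (θ 1) (θ 0) (θ 2) ∧ energyDensityTT' 1 (θ 1) (θ 0) (θ 2) ≤ R)
    {κ : Type*} [Fintype κ] {w : κ → Site 3} (hw : ∀ b, w b 0 ≠ 0) {R' : ℝ} (hR' : 1 ≤ R')
    (hwR' : ∀ b, w b ∈ thicken ({0} : Finset (Site 3)) R') :
    HoldsOn (fun p : OneBandCoord → ℝ => ∀ tz : κ → ℝ, ∑ b, |tz b| ≤ |p .tperpOverT| →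
      L - 2 * (29/100 : ℝ) ≤
          (layeredHubbardTTPrime 1 (p .tpOverT) (p .UOverT) w tz).tiGroundEnergyDensityAt R' (p .filling) ∧
        (layeredHubbardTTPrime 1 (p .tpOverT) (p .UOverT) w tz).tiGroundEnergyDensityAt R' (p .filling) ≤ R)
      boxYBCO6M_M64 := by
  have h := holdsOn_layeredHubbardTTPrime_of_window (B := boxYBCO6M_M64) (eU := yBCO6M_M64_U) (eS := yBCO6M_M64_tp)
    (eN := yBCO6M_M64_n) (eZ := yBCO6M_M64_tperp) rfl rfl rfl rfl
    (by rw [yBCO6M_M64_U, Entry.encl_ofEnds_fst]; norm_num)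
    (by rw [yBCO6M_M64_n, Entry.encl_ofEnds_fst]; norm_num)
    (by rw [yBCO6M_M64_n, Entry.encl_ofEnds_snd]; norm_num)
    (L := L) (R := R) (by rw [yBCO6M_M64_s2Lo, yBCO6M_M64_s2Hi]; exact hE) hw hR' hwR'
  rw [yBCO6M_M64_tperp_abs] at h
  have hc : (((29/100 : ℚ)) : ℝ) = (29/100 : ℝ) := by norm_num
  rw [hc] at h
  exact h

/-- **BILAYER entry point on `boxYBCO6M_M64`** (hubbard-box-p1's `holdsOn_bilayerHubbardTTPrime_of_window`: stacking period 2, intra-bilayer vertical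
amplitude `p tperp/t`, inter-bilayer `t⊥'` with `|t⊥'| ≤ |p tperp/t|`): an S2 window `[L, R]` on the cell gives, at every member and every such `t⊥'`,
`L − 2·(29/100) ≤` (variational cell energy of the bilayer crystal over period-2 periodic states at cell filling `p n`) `≤ R`. [folklore] -/
theorem boxYBCO6M_M64_bilayerEnergyWord {L R : ℝ}
    (hE : ∀ θ ∈ Set.Icc (![27/5, -7/25, 99/100] : Fin 3 → ℝ) ![68/5, -3/20, 101/100],
      L ≤ energyDensityTT' 1 (θ 1) (θ 0) (θ 2) ∧ energyDensityTT' 1 (θ 1) (θ 0) (θ 2) ≤ R) :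
    HoldsOn (fun p : OneBandCoord → ℝ => ∀ tperp' : ℝ, |tperp'| ≤ |p .tperpOverT| →
      L - 2 * (29/100 : ℝ) ≤
          infCellEnergyOn (periodicStatesAt (stackPeriods 2 1) (p .filling))
            (periodicLayeredHubbardTTPrimeViews 1 1 (p .tpOverT) (p .UOverT)
              (fun _ : Fin 1 => (unitVec (0 : Fin 3) : Site 3)) fun j _ => ![p .tperpOverT, tperp'] j) 1 ∧
        infCellEnergyOn (periodicStatesAt (stackPeriods 2 1) (p .filling))
            (periodicLayeredHubbardTTPrimeViews 1 1 (p .tpOverT) (p .UOverT)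
              (fun _ : Fin 1 => (unitVec (0 : Fin 3) : Site 3)) fun j _ => ![p .tperpOverT, tperp'] j) 1 ≤ R)
      boxYBCO6M_M64 := by
  have h := holdsOn_bilayerHubbardTTPrime_of_window (B := boxYBCO6M_M64) (eU := yBCO6M_M64_U) (eS := yBCO6M_M64_tp)
    (eN := yBCO6M_M64_n) (eZ := yBCO6M_M64_tperp) rfl rfl rfl rfl
    (by rw [yBCO6M_M64_U, Entry.encl_ofEnds_fst]; norm_num)
    (by rw [yBCO6M_M64_n, Entry.encl_ofEnds_fst]; norm_num)
    (by rw [yBCO6M_M64_n, Entry.encl_ofEnds_snd]; norm_num)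
    (L := L) (R := R) (by rw [yBCO6M_M64_s2Lo, yBCO6M_M64_s2Hi]; exact hE)
  rw [yBCO6M_M64_tperp_abs] at h
  have hc : (((29/100 : ℚ)) : ℝ) = (29/100 : ℝ) := by norm_num
  rw [hc] at h
  exact h

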